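import Summits.QuantumAdvantage.QuantumAdvantage.Theorems.CubicForrelationSignedExactCubicForrelationNotPrBPPStubCubeKernelStatsLemmas
import Summits.QuantumAdvantage.QuantumAdvantage.Theorems.CubicForrelationSignedExactCubicForrelationNotPrBPPStubNoTrapTransportLemmas

/-!
# Crux `CubicForrelation.SignedExactCubicForrelationNotPrBPP` (stmt-QuantumAdvantage-13932), line `dual-pingpong-frame`
# (classify-then-count cut): stub `stub_cubeKernelStats` — candidate space, event, density `≥ 1/64`

Support file 2/3 (`--supports stmt-QuantumAdvantage-13932`) for the registered stub `stub_cubeKernelStats` (kernel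
statistics of the cube template `b(y', y'') = y'·cube^k(y'') ⊕ h(y'')`, `k = k' + 1` blocks, `n = 6k`, at the pair
`(0,0)`; proved in `…StubCubeKernelStats.lean`). Namespace `CubeKS`; every set is a `Finset` (no `Prop` definitions).

* `Kset b xs` / `goodSet b xs` — the candidate space `K(xs) = {v : D_(x_j) D_v b ≡ const ∀ j}` and its new-good part,
  in the VERBATIM shape of the registered statement at `S = U = {0}` (`memK_iff`; `K(xs)` is `⊕`-closed, `bxor_memK`).
* `S1 r` — block columns with two distinct non-zero entries; `Ev k' r` — the event on probe tuples: block `0` of every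
  `x''_j` vanishes and every other block column lies in `S1`.
* On the event, for EVERY `h`: `blk_τ_eq_zero` (a `v ∈ K(xs)` has `v''` supported in block `0`: `probe_unit` + `apn`),
  `blk_ξ_eq_zero` (a frame vector `(v',0) ∈ K(xs)` has `v'` supported in block `0`: `probe_pure` + `sep`), hence
  `card_Kset_le : |K(xs)| ≤ 64` (fibres of `v ↦ v''` are translates of `K(xs) ∩ (Y' ⊕ 0)`); and `goodvec_mem_goodSet`:
  `((1,1,1)_0, 0) ∈ K(xs)` is a new good vector, witnessed by the M-subspace `Y' ⊕ 0` (flat for every `h`,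
  `|Y' ⊕ 0|² = 2ⁿ`). Together: `frac_ge`, the new-good density of `K(xs)` is `≥ 1/64` on the event.

References: C. Carlet, *Boolean Functions for Cryptography and Coding Theory*, CUP 2020, Prop. 54 (M-subspaces of
Maiorana–McFarland functions: `Y' ⊕ 0`) and §2.2.2 (derivatives) [Carlet2020]; K. Nyberg, EUROCRYPT '93 (APN power maps)
[Nyberg1994]. NOT here: the size of the event and the arithmetic (`…StubCubeKernelStats.lean`). -/

noncomputable section

set_option linter.dupNamespace false -- D-0017: single-problem summit ⇒ `QuantumAdvantage.QuantumAdvantage` by design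

namespace Summit.QuantumAdvantage.QuantumAdvantage.Theorems.SignedExactCubicForrelationNotPrBPP

open Finset
open Literature.Computability.Complexity Literature.Computability.QuantumComplexity
open Literature.Computability.QuantumComplexity.BuzetChailloux (bxor zeroVec bxor_self bxor_comm
  bxor_zeroVec zeroVec_bxor bxor_bxor_cancel_left)
open PolarGeometry (bdot_comm bdot_bxor_left bdot_bxor_right bxor_bxor_assoc bxor_bxor_swap exists_append
  bxor_append xor_frame_eq)

namespace CubeKS

/-! ### Projections -/

section Proj

variable {m : ℕ}

/-- First half `x'` of `x = (x', x'')`. [folklore] -/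
def ξ (x : Fin (m + m) → Bool) : Fin m → Bool := fun i => x (Fin.castAdd m i)

/-- Second half `x''` of `x = (x', x'')`. [folklore] -/
def τ (x : Fin (m + m) → Bool) : Fin m → Bool := fun i => x (Fin.natAdd m i)

/-- `x = (x', x'')`. [folklore] -/
theorem append_ξ_τ (x : Fin (m + m) → Bool) : Fin.append (ξ x) (τ x) = x := Fin.append_castAdd_natAdd

/-- `(a, w)'' = w`. [folklore] -/
@[simp] theorem τ_append (a w : Fin m → Bool) : τ (Fin.append a w) = w := funext fun i => Fin.append_right a w i

/-- `(a, w)' = a`. [folklore] -/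
@[simp] theorem ξ_append (a w : Fin m → Bool) : ξ (Fin.append a w) = a := funext fun i => Fin.append_left a w i

/-- `τ` is additive (definitionally). [folklore] -/
theorem τ_bxor (x y : Fin (m + m) → Bool) : τ (bxor x y) = bxor (τ x) (τ y) := rfl

end Proj

/-! ### The candidate space `K(xs)` and the good set of the registered statement (`S = U = {0}`) -/

section Kset

variable {n : ℕ}

/-- `D_u D_v b (x)`. [folklore] -/
def Dd (b : (Fin n → Bool) → Bool) (u v x : Fin n → Bool) : Bool :=
  b x ^^ b (bxor x u) ^^ b (bxor x v) ^^ b (bxor x (bxor u v))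

/-- The candidate space `K(xs)` of the registered statement at `S = U = {0}` (verbatim shape). [folklore] -/
def Kset (b : (Fin n → Bool) → Bool) {r : ℕ} (xs : Fin r → Fin n → Bool) : Finset (Fin n → Bool) :=
  Finset.univ.filter fun (v : Fin n → Bool) =>
    (∀ s ∈ ({zeroVec} : Finset (Fin n → Bool)), ∀ x, (b x ^^ b (bxor x s) ^^ b (bxor x v) ^^ b (bxor x (bxor s v))) = false) ∧
    (∀ u ∈ ({zeroVec} : Finset (Fin n → Bool)), ((Finset.univ.filter fun i => u i && v i).card).bodd = false) ∧
    ∀ j, (∀ y z : Fin n → Bool, ((b z ^^ b (bxor z (xs j)) ^^ b (bxor z v) ^^ b (bxor z (bxor (xs j) v))) ^^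
      (b (bxor z y) ^^ b (bxor (bxor z y) (xs j)) ^^ b (bxor (bxor z y) v) ^^ b (bxor (bxor z y) (bxor (xs j) v)))) = false)

/-- The new-good part of `K(xs)` of the registered statement at `S = U = {0}` (classical filter, verbatim shape).
[folklore] -/
def goodSet (b : (Fin n → Bool) → Bool) {r : ℕ} (xs : Fin r → Fin n → Bool) : Finset (Fin n → Bool) :=
  @Finset.filter (Fin n → Bool) (fun v => v ∉ ({zeroVec} : Finset (Fin n → Bool)) ∧
    (∃ V : Finset (Fin n → Bool), ((zeroVec ∈ V ∧ ∀ x ∈ V, ∀ y ∈ V, bxor x y ∈ V) ∧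
      (((V).card : ℝ) ^ 2 = (2 : ℝ) ^ n) ∧
      ∀ u ∈ V, ∀ v ∈ V, ∀ x, (b x ^^ b (bxor x u) ^^ b (bxor x v) ^^ b (bxor x (bxor u v))) = false) ∧
      ({zeroVec} : Finset (Fin n → Bool)) ⊆ V ∧ v ∈ V ∧
      (∀ s ∈ V, ∀ u ∈ ({zeroVec} : Finset (Fin n → Bool)), ((Finset.univ.filter fun i => s i && u i).card).bodd = false)))
    (Classical.decPred _) (Kset b xs)

/-- The `S = {0}` clause of `K(xs)` is empty. [folklore] -/
theorem condS_triv (b : (Fin n → Bool) → Bool) (v : Fin n → Bool) :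
    ∀ s ∈ ({zeroVec} : Finset (Fin n → Bool)), ∀ x,
      (b x ^^ b (bxor x s) ^^ b (bxor x v) ^^ b (bxor x (bxor s v))) = false := by
  intro s hs x
  rw [Finset.mem_singleton.1 hs, bxor_zeroVec, zeroVec_bxor]
  cases b x <;> cases b (bxor x v) <;> rfl

/-- The `U = {0}` clause of `K(xs)` is empty. [folklore] -/
theorem condU_triv (v : Fin n → Bool) :
    ∀ u ∈ ({zeroVec} : Finset (Fin n → Bool)), (univ.filter fun i => u i && v i).card.bodd = false := by
  intro u hu; rw [Finset.mem_singleton.1 hu]; exact Covariance.zeroVec_bdot v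

/-- Membership in `K(xs)`: the probe conditions `D_(x_j) D_v b ≡ const`. [folklore] -/
theorem memK_iff {b : (Fin n → Bool) → Bool} {r : ℕ} {xs : Fin r → Fin n → Bool} {v : Fin n → Bool} :
    v ∈ Kset b xs ↔ ∀ j (y z : Fin n → Bool), (Dd b (xs j) v z ^^ Dd b (xs j) v (bxor z y)) = false := by
  unfold Kset
  rw [Finset.mem_filter]
  exact ⟨fun h => h.2.2.2, fun h => ⟨Finset.mem_univ _, condS_triv b v, condU_triv v, h⟩⟩

/-- `K(xs)` is closed under `⊕` (cocycle law of second differences). [folklore] -/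
theorem bxor_memK {b : (Fin n → Bool) → Bool} {r : ℕ} {xs : Fin r → Fin n → Bool} {v w : Fin n → Bool}
    (hv : v ∈ Kset b xs) (hw : w ∈ Kset b xs) : bxor v w ∈ Kset b xs := by
  rw [memK_iff] at hv hw ⊢
  intro j y z
  have hD : ∀ u v x, Dd b u v x = (b x ^^ b (bxor x u) ^^ b (bxor x v) ^^ b (bxor x (bxor u v))) :=
    fun _ _ _ => rfl
  rw [RadicalGood.D_bxor_right (Dd b) hD (xs j) v w z, RadicalGood.D_bxor_right (Dd b) hD (xs j) v w (bxor z y),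
    ← bxor_bxor_assoc z y w, bxor_bxor_swap z y w]
  have h1 := hv j y (bxor z w)
  have h2 := hw j y z
  revert h1 h2
  cases Dd b (xs j) v (bxor z w) <;> cases Dd b (xs j) v (bxor (bxor z w) y) <;>
    cases Dd b (xs j) w z <;> cases Dd b (xs j) w (bxor z y) <;> decide

/-- A vector orthogonal to everything is `0` (nondegeneracy, `Covariance.eq_of_bdot_eq`). [folklore] -/
theorem eq_zeroVec_of_bdot (w : Fin n → Bool)
    (h : ∀ u : Fin n → Bool, (univ.filter fun i => u i && w i).card.bodd = false) : w = zeroVec :=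
  Covariance.eq_of_bdot_eq fun u => (h u).trans (NoTrap.bdot_zeroVec u).symm

end Kset

/-! ### The cube template `b(y', y'') = y'·cube^k(y'') ⊕ h(y'')`, `k = k' + 1` blocks -/

section Template

variable {k' : ℕ} {h : (Fin ((k' + 1) * 3) → Bool) → Bool} {b : (Fin ((k' + 1) * 3 + (k' + 1) * 3) → Bool) → Bool}

/-- Columns with two DISTINCT non-zero entries (the block candidate space is then trivial). [folklore] -/
def S1 (r : ℕ) : Finset (Fin r → Fin 3 → Bool) :=
  univ.filter fun c => ∃ j j', c j ≠ zeroVec ∧ c j' ≠ zeroVec ∧ c j ≠ c j'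

/-- Membership in `S1`. [folklore] -/
theorem mem_S1 {r : ℕ} {c : Fin r → Fin 3 → Bool} :
    c ∈ S1 r ↔ ∃ j j', c j ≠ zeroVec ∧ c j' ≠ zeroVec ∧ c j ≠ c j' := by
  unfold S1; rw [Finset.mem_filter]; exact ⟨fun h => h.2, fun h => ⟨Finset.mem_univ _, h⟩⟩

/-- The event on probe tuples: block `0` of every `x''_j` vanishes, every other block column lies in `S1`.
[folklore] -/
def Ev (k' r : ℕ) : Finset (Fin r → Fin ((k' + 1) * 3 + (k' + 1) * 3) → Bool) :=
  univ.filter fun xs => (∀ j, blk (τ (xs j)) (0 : Fin (k' + 1)) = zeroVec) ∧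
    ∀ q : Fin k', (fun j => blk (τ (xs j)) q.succ) ∈ S1 r

/-- Membership in `Ev`. [folklore] -/
theorem mem_Ev {r : ℕ} {xs : Fin r → Fin ((k' + 1) * 3 + (k' + 1) * 3) → Bool} :
    xs ∈ Ev k' r ↔ (∀ j, blk (τ (xs j)) (0 : Fin (k' + 1)) = zeroVec) ∧
      ∀ q : Fin k', (fun j => blk (τ (xs j)) q.succ) ∈ S1 r := by
  unfold Ev; rw [Finset.mem_filter]; exact ⟨fun h => h.2, fun h => ⟨Finset.mem_univ _, h⟩⟩

/-- **Junk directions die off block `0`**: on the event, `v ∈ K(xs)` has `v''` supported in block `0`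
(unit-frame test `probe_unit` + APN in a block whose column has two distinct non-zero entries). [folklore] -/
theorem blk_τ_eq_zero
    (hb : ∀ y' y'' : Fin ((k' + 1) * 3) → Bool, b (Fin.append y' y'') =
      ((Finset.univ.filter fun i => y' i && cubeP (k' + 1) y'' i).card.bodd ^^ h y''))
    {r : ℕ} {xs : Fin r → Fin ((k' + 1) * 3 + (k' + 1) * 3) → Bool} (hE : xs ∈ Ev k' r)
    {v : Fin ((k' + 1) * 3 + (k' + 1) * 3) → Bool} (hv : v ∈ Kset b xs) (q : Fin k') :
    blk (τ v) q.succ = zeroVec := by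
  obtain ⟨v', v'', rfl⟩ := exists_append v
  rw [τ_append]
  obtain ⟨j, j', hj, hj', hjj'⟩ := mem_S1.1 ((mem_Ev.1 hE).2 q)
  have key : ∀ i, Bc (blk (τ (xs i)) q.succ) (blk v'' q.succ) = zeroVec := by
    intro i
    obtain ⟨x', x'', hx⟩ := exists_append (xs i)
    have hK := (memK_iff.1 hv) i
    rw [← hx] at hK ⊢
    rw [τ_append]
    have hBv : Bv (cubeP (k' + 1)) x'' v'' = zeroVec := by
      refine eq_zeroVec_of_bdot _ fun u' => ?_
      have h1 := hK (Fin.append u' zeroVec) zeroVec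
      unfold Dd at h1
      simp only [zeroVec_bxor] at h1
      rwa [probe_unit hb x' x'' v' v'' u'] at h1
    have := congrArg (fun w => blk w q.succ) hBv
    simpa only [blk_Bv, blk_zeroVec] using this
  rcases apn hj (key j) with h0 | h1
  · exact h0
  · rcases apn hj' (key j') with h0' | h1'
    · exact h0'
    · exact absurd (h1.symm.trans h1') hjj'

/-- **Frame directions die off block `0`**: on the event, `(v', 0) ∈ K(xs)` has `v'` supported in block `0`
(pure-`y''` test `probe_pure` + separation `sep`). [folklore] -/
theorem blk_ξ_eq_zero
    (hb : ∀ y' y'' : Fin ((k' + 1) * 3) → Bool, b (Fin.append y' y'') =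
      ((Finset.univ.filter fun i => y' i && cubeP (k' + 1) y'' i).card.bodd ^^ h y''))
    {r : ℕ} {xs : Fin r → Fin ((k' + 1) * 3 + (k' + 1) * 3) → Bool} (hE : xs ∈ Ev k' r)
    {v' : Fin ((k' + 1) * 3) → Bool} (hv : Fin.append v' zeroVec ∈ Kset b xs) (q : Fin k') :
    blk v' q.succ = zeroVec := by
  obtain ⟨j, j', hj, hj', hjj'⟩ := mem_S1.1 ((mem_Ev.1 hE).2 q)
  have key : ∀ i w, bd3 (blk v' q.succ) (Bc (blk (τ (xs i)) q.succ) w) = false := by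
    intro i w
    obtain ⟨x', x'', hx⟩ := exists_append (xs i)
    have hK := (memK_iff.1 hv) i
    rw [← hx] at hK ⊢
    rw [τ_append]
    have h1 := hK (Fin.append zeroVec (embed q.succ w)) zeroVec
    unfold Dd at h1
    simp only [zeroVec_bxor] at h1
    rwa [probe_pure hb x' x'' v' (embed q.succ w), Bv_embed, bdot_embed_right] at h1
  exact sep hj hj' hjj' (key j) (key j')

/-- **The good vectors**: `((a)_0, 0) ∈ K(xs)` whenever block `0` of every `x''_j` vanishes
(`D_(x_j) D_((a)_0,0) b ≡ 0` by `d2_frame`). [folklore] -/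
theorem goodvec_memK
    (hb : ∀ y' y'' : Fin ((k' + 1) * 3) → Bool, b (Fin.append y' y'') =
      ((Finset.univ.filter fun i => y' i && cubeP (k' + 1) y'' i).card.bodd ^^ h y''))
    {r : ℕ} {xs : Fin r → Fin ((k' + 1) * 3 + (k' + 1) * 3) → Bool}
    (hE0 : ∀ j, blk (τ (xs j)) (0 : Fin (k' + 1)) = zeroVec) (a : Fin 3 → Bool) :
    Fin.append (embed 0 a) zeroVec ∈ Kset b xs := by
  refine memK_iff.2 fun j y z => ?_
  obtain ⟨x', x'', hx⟩ := exists_append (xs j)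
  have hx0 : blk x'' 0 = zeroVec := by rw [← hE0 j, ← hx, τ_append]
  have hD : ∀ z, Dd b (xs j) (Fin.append (embed 0 a) zeroVec) z = false := by
    intro z
    obtain ⟨z', z'', rfl⟩ := exists_append z
    rw [← hx]
    unfold Dd
    rw [d2_frame hb x' x'' (embed 0 a) z' z'', bdot_embed_left, blk_bxor, blk_cubeP, blk_cubeP, blk_bxor, hx0,
      bxor_zeroVec, bxor_self]
    simp [bd3, zeroVec]
  rw [hD, hD]; rfl

/-- The frame vector `((1,1,1)_0, 0)` is non-zero. [folklore] -/
theorem goodvec_ne_zero :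
    (Fin.append (embed (0 : Fin (k' + 1)) (fun _ => true)) zeroVec : Fin ((k' + 1) * 3 + (k' + 1) * 3) → Bool) ≠
      zeroVec := by
  intro hz
  have h1 := congrFun hz (Fin.castAdd ((k' + 1) * 3) (finProdFinEquiv ((0 : Fin (k' + 1)), (0 : Fin 3))))
  rw [Fin.append_left] at h1
  have h2 : embed (0 : Fin (k' + 1)) (fun _ => true) (finProdFinEquiv ((0 : Fin (k' + 1)), (0 : Fin 3))) = true :=
    congrFun (blk_embed_self (0 : Fin (k' + 1)) (fun _ : Fin 3 => true)) 0
  rw [h2] at h1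
  exact Bool.noConfusion h1

/-- `a ↦ (a, 0)` is injective. [folklore] -/
theorem append_zero_injective {m : ℕ} :
    Function.Injective fun a : Fin m → Bool => Fin.append a (zeroVec : Fin m → Bool) := fun a c hac => by
  have := congrArg ξ hac
  simpa only [ξ_append] using this

/-- **The good vectors are new good vectors**: `((1,1,1)_0, 0)` lies in the good set, witnessed by the
M-subspace `Y' ⊕ 0` (flat for every `h` by `d2_frame_frame`, `|Y' ⊕ 0|² = 2ⁿ`). [cite: Carlet2020, Prop. 54] -/
theorem goodvec_mem_goodSet
    (hb : ∀ y' y'' : Fin ((k' + 1) * 3) → Bool, b (Fin.append y' y'') =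
      ((Finset.univ.filter fun i => y' i && cubeP (k' + 1) y'' i).card.bodd ^^ h y''))
    {r : ℕ} {xs : Fin r → Fin ((k' + 1) * 3 + (k' + 1) * 3) → Bool}
    (hE0 : ∀ j, blk (τ (xs j)) (0 : Fin (k' + 1)) = zeroVec) :
    Fin.append (embed (0 : Fin (k' + 1)) (fun _ => true)) zeroVec ∈ goodSet b xs := by
  classical
  set V : Finset (Fin ((k' + 1) * 3 + (k' + 1) * 3) → Bool) :=
    (univ : Finset (Fin ((k' + 1) * 3) → Bool)).image fun a => Fin.append a zeroVec with hVdef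
  have h0V : zeroVec ∈ V := Finset.mem_image.2 ⟨zeroVec, Finset.mem_univ _, append_zeroVec⟩
  have haddV : ∀ x ∈ V, ∀ y ∈ V, bxor x y ∈ V := by
    intro x hx y hy
    obtain ⟨a, -, rfl⟩ := Finset.mem_image.1 hx
    obtain ⟨c, -, rfl⟩ := Finset.mem_image.1 hy
    exact Finset.mem_image.2 ⟨bxor a c, Finset.mem_univ _, by rw [bxor_append, bxor_zeroVec]⟩
  have hcardV : ((V.card : ℕ) : ℝ) ^ 2 = (2 : ℝ) ^ ((k' + 1) * 3 + (k' + 1) * 3) := by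
    have hc : V.card = 2 ^ ((k' + 1) * 3) := by
      rw [hVdef, Finset.card_image_of_injective _ append_zero_injective, Finset.card_univ, Fintype.card_fun,
        Fintype.card_bool, Fintype.card_fin]
    rw [hc, Nat.cast_pow, Nat.cast_ofNat, ← pow_mul, pow_right_inj₀ (by norm_num) (by norm_num)]
    ring
  have hflatV : ∀ u ∈ V, ∀ v ∈ V, ∀ x, (b x ^^ b (bxor x u) ^^ b (bxor x v) ^^ b (bxor x (bxor u v))) = false := by
    intro u hu v hv x
    obtain ⟨a, -, rfl⟩ := Finset.mem_image.1 hu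
    obtain ⟨c, -, rfl⟩ := Finset.mem_image.1 hv
    obtain ⟨x', x'', rfl⟩ := exists_append x
    exact d2_frame_frame hb a c x' x''
  have hmemV : Fin.append (embed (0 : Fin (k' + 1)) (fun _ => true)) zeroVec ∈ V :=
    Finset.mem_image.2 ⟨_, Finset.mem_univ _, rfl⟩
  have horth : ∀ s ∈ V, ∀ u ∈ ({zeroVec} : Finset (Fin ((k' + 1) * 3 + (k' + 1) * 3) → Bool)),
      ((Finset.univ.filter fun i => s i && u i).card).bodd = false := by
    intro s _ u hu
    rw [Finset.mem_singleton.1 hu]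
    exact NoTrap.bdot_zeroVec s
  unfold goodSet
  refine (@Finset.mem_filter _ _ (Classical.decPred _) _ _).2 ⟨goodvec_memK hb hE0 _, ?_, ?_⟩
  · exact fun hm => goodvec_ne_zero (Finset.mem_singleton.1 hm)
  · exact ⟨V, ⟨⟨h0V, haddV⟩, hcardV, hflatV⟩, Finset.singleton_subset_iff.2 h0V, hmemV, horth⟩

/-- `|𝔽₂³| = 8`. [folklore] -/
theorem card_block : (univ : Finset (Fin 3 → Bool)).card = 8 := by
  rw [Finset.card_univ, Fintype.card_fun, Fintype.card_bool, Fintype.card_fin]; rfl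

/-- **The candidate space is small on the event**: `|K(xs)| ≤ 64` (the `y''`-projection of `K(xs)` has
`≤ 8` values by `blk_τ_eq_zero`, and each fibre is a translate of `K(xs) ∩ (Y' ⊕ 0)`, of size `≤ 8` by
`blk_ξ_eq_zero`; `K(xs)` is `⊕`-closed). [folklore] -/
theorem card_Kset_le
    (hb : ∀ y' y'' : Fin ((k' + 1) * 3) → Bool, b (Fin.append y' y'') =
      ((Finset.univ.filter fun i => y' i && cubeP (k' + 1) y'' i).card.bodd ^^ h y''))
    {r : ℕ} {xs : Fin r → Fin ((k' + 1) * 3 + (k' + 1) * 3) → Bool} (hE : xs ∈ Ev k' r) :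
    (Kset b xs).card ≤ 64 := by
  classical
  have himg : ((Kset b xs).image τ).card ≤ 8 := by
    have hsub : (Kset b xs).image τ ⊆
        (univ : Finset (Fin 3 → Bool)).image fun c => (embed (0 : Fin (k' + 1)) c : Fin ((k' + 1) * 3) → Bool) := by
      intro w hw
      obtain ⟨v, hv, rfl⟩ := Finset.mem_image.1 hw
      refine Finset.mem_image.2 ⟨blk (τ v) 0, Finset.mem_univ _, eq_of_blk_eq fun q => ?_⟩
      rw [blk_embed]
      refine Fin.cases ?_ (fun q' => ?_) q
      · rw [if_pos rfl]
      · rw [if_neg (Fin.succ_ne_zero q'), blk_τ_eq_zero hb hE hv q']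
    calc ((Kset b xs).image τ).card ≤ _ := Finset.card_le_card hsub
      _ ≤ (univ : Finset (Fin 3 → Bool)).card := Finset.card_image_le
      _ = 8 := card_block
  have hfib : ∀ w ∈ (Kset b xs).image τ, ((Kset b xs).filter fun v => τ v = w).card ≤ 8 := by
    intro w hw
    obtain ⟨v₀, hv₀, rfl⟩ := Finset.mem_image.1 hw
    have hsub : ((Kset b xs).filter fun v => τ v = τ v₀) ⊆
        (univ : Finset (Fin 3 → Bool)).image fun c => bxor v₀ (Fin.append (embed (0 : Fin (k' + 1)) c) zeroVec) := by
      intro v hv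
      obtain ⟨hvK, hτv⟩ := Finset.mem_filter.1 hv
      have hu : bxor v₀ v ∈ Kset b xs := bxor_memK hv₀ hvK
      have hτu : τ (bxor v₀ v) = zeroVec := by rw [τ_bxor, hτv, bxor_self]
      have hu' : bxor v₀ v = Fin.append (ξ (bxor v₀ v)) zeroVec := by
        rw [← hτu]; exact (append_ξ_τ _).symm
      rw [hu'] at hu
      have hξ : ξ (bxor v₀ v) = embed 0 (blk (ξ (bxor v₀ v)) 0) := by
        refine eq_of_blk_eq fun q => ?_
        rw [blk_embed]
        refine Fin.cases ?_ (fun q' => ?_) q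
        · rw [if_pos rfl]
        · rw [if_neg (Fin.succ_ne_zero q'), blk_ξ_eq_zero hb hE hu q']
      refine Finset.mem_image.2 ⟨blk (ξ (bxor v₀ v)) 0, Finset.mem_univ _, ?_⟩
      rw [← hξ, ← hu', bxor_bxor_cancel_left]
    calc _ ≤ _ := Finset.card_le_card hsub
      _ ≤ (univ : Finset (Fin 3 → Bool)).card := Finset.card_image_le
      _ = 8 := card_block
  calc (Kset b xs).card = ∑ w ∈ (Kset b xs).image τ, ((Kset b xs).filter fun v => τ v = w).card :=
        Finset.card_eq_sum_card_image τ _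
    _ ≤ ∑ _w ∈ (Kset b xs).image τ, 8 := Finset.sum_le_sum hfib
    _ = ((Kset b xs).image τ).card * 8 := by rw [Finset.sum_const, smul_eq_mul]
    _ ≤ 8 * 8 := by omega

/-- **New-good density on the event**: `≥ 1/64`. [folklore] -/
theorem frac_ge
    (hb : ∀ y' y'' : Fin ((k' + 1) * 3) → Bool, b (Fin.append y' y'') =
      ((Finset.univ.filter fun i => y' i && cubeP (k' + 1) y'' i).card.bodd ^^ h y''))
    {r : ℕ} {xs : Fin r → Fin ((k' + 1) * 3 + (k' + 1) * 3) → Bool} (hE : xs ∈ Ev k' r) :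
    (1 : ℝ) / 64 ≤ ((goodSet b xs).card : ℝ) / ((Kset b xs).card : ℝ) := by
  have h1 : (1 : ℝ) ≤ (goodSet b xs).card := by
    exact_mod_cast Finset.card_pos.2 ⟨_, goodvec_mem_goodSet hb (mem_Ev.1 hE).1⟩
  have h2 : ((Kset b xs).card : ℝ) ≤ 64 := by exact_mod_cast card_Kset_le hb hE
  have h3 : (0 : ℝ) < (Kset b xs).card := by
    exact_mod_cast Finset.card_pos.2 ⟨_, goodvec_memK hb (mem_Ev.1 hE).1 fun _ => true⟩
  calc (1 : ℝ) / 64 ≤ 1 / (Kset b xs).card := one_div_le_one_div_of_le h3 h2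
    _ ≤ _ := div_le_div_of_nonneg_right h1 h3.le

end Template

end CubeKS

/-- **Registered brick `cubeKS_kset_bxor`** (helper 2/3 of stub `stub_cubeKernelStats`, line `dual-pingpong-frame`,
crux stmt-QuantumAdvantage-13932): the candidate space `K(xs) = {v : D_(x_j) D_v b ≡ const ∀ j}` of ANY Boolean `b` is
closed under `⊕` (cocycle law of second differences). [folklore] -/
theorem cubeKS_kset_bxor : ∀ {n r : ℕ} (b : (Fin n → Bool) → Bool) (xs : Fin r → Fin n → Bool) (v w : Fin n → Bool), (∀ j, ∀ y z : Fin n → Bool, ((b z ^^ b (bxor z (xs j)) ^^ b (bxor z v) ^^ b (bxor z (bxor (xs j) v))) ^^ (b (bxor z y) ^^ b (bxor (bxor z y) (xs j)) ^^ b (bxor (bxor z y) v) ^^ b (bxor (bxor z y) (bxor (xs j) v)))) = false) → (∀ j, ∀ y z : Fin n → Bool, ((b z ^^ b (bxor z (xs j)) ^^ b (bxor z w) ^^ b (bxor z (bxor (xs j) w))) ^^ (b (bxor z y) ^^ b (bxor (bxor z y) (xs j)) ^^ b (bxor (bxor z y) w) ^^ b (bxor (bxor z y) (bxor (xs j) w))))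 = false) → ∀ j, ∀ y z : Fin n → Bool, ((b z ^^ b (bxor z (xs j)) ^^ b (bxor z (bxor v w)) ^^ b (bxor z (bxor (xs j) (bxor v w)))) ^^ (b (bxor z y) ^^ b (bxor (bxor z y) (xs j)) ^^ b (bxor (bxor z y) (bxor v w)) ^^ b (bxor (bxor z y) (bxor (xs j) (bxor v w))))) = false :=
  fun b xs v w hv hw => (CubeKS.memK_iff (b := b) (xs := xs) (v := bxor v w)).1
    (CubeKS.bxor_memK ((CubeKS.memK_iff (b := b) (xs := xs) (v := v)).2 hv)
      ((CubeKS.memK_iff (b := b) (xs := xs) (v := w)).2 hw))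

end Summit.QuantumAdvantage.QuantumAdvantage.Theorems.SignedExactCubicForrelationNotPrBPP
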